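import Summits.HodgeConjecture.HodgeConjecture.Theorems.R90S6BCLineSymm                 -- ★ W7-b (i) `glHeckeEigenpoly_bcLine_even` (p09): `λ^{GL₃}_{(z,1,z⁻¹)}(φ) = Q_φ(z + z⁻¹)`
import Summits.HodgeConjecture.HodgeConjecture.Theorems.R90S6HeckeEigenpolyTwoExists      -- ★ W3-c′ `exists_hecke_eigenpoly_two`: every `Q(z + z⁻¹)` is a `U(J₀,2)` eigen-polynomial
import Summits.HodgeConjecture.HodgeConjecture.Theorems.R90S6SatakeGraphPartnerUnique    -- ★ W3-b `satakeGraph_partner_unique` (p03): the `λ_{(z,1)}` separate `ℋ(U(J₀,2)(E_w), K₀)`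
import HarnessLib

/-!
# R90 · S6 «Ch. 14.1–14.5 stable TF» — WAVE 10 card W10-a (E.1)–(E.3), (E.6): THE GRAPH OF `η̂₁ : ℋ(GL₃(K), GL₃(𝒪)) → ℋ(U(J₀,2)(E_w), K₀)` —
# `∀ φ ∃! fH, GraphBCEta₁ φ fH`, and the sign vs `ξ̂_H ∘ ψ̂_G` documented once (`Theorems/R90S6EtaOneGraphExists.lean`; DAG r5 row E1.4.4.1.2)

Cell `hodgecm-mathlib`, crux H413 (`stmt-HodgeConjecture-24833`), route of record `HCCMUnconditional`; programme R90-TF, section S6 (base `R90-C14`),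
seat R90-C14-p06 (g0); S6 dealer R90-C14-plan (g2) NEW CARD W10-a (R90 bus 2026-09-05T00:05:16Z «row E1.4.4.1.2 THE η̂-MAPS IN GRAPH CURRENCY … math
buildable now exactly like ★ W3–W5»); census of record `R90/R90-C14-p06/g0/CENSUS-W10a.v1.md` (R90 bus, p06 STEP 1).  Dealer rulings R1–R3 (R90 bus 2026-09-05T00:09:50Z): R1 predicate of record = print's UNSIGNED η̂₁; (E.6) signed-composite corollary YES; R3 this file = the proof-lane
half ((E.1)–(E.3) + (E.6); THEOREMS ONLY, no definition), its sequel `Theorems/R90S6EtaOneGraphPartner.lean` = the API module (defs (E.4)).  CLONE, name for name, of §1 of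
★ p09 (g0)'s `Theorems/R90S6BCGraphPartner.lean` (W7-b (ii), `ψ̂_G`) with the unitary side at `N = 2`.  Lane `--supports stmt-HodgeConjecture-24833 --as helper`;
imports = ★ S6 Theorems modules + HarnessLib, no `Cruxes` import.

THE PRINT [Rogawski1990, §4.7 p. 48; §4.10 pp. 56–58].  `G = U(3)`, `H = U(2) × U(1)`, `G̃ = Res_{E∕F} GL₃`; at an inert unramified `w ∣ v` the L-embedding
`η₁ : ᴸH → ᴸG̃` (§4.7, case `a ≢ b (mod 2)`: `η₁(w) = 1 × w` on `W_E` — NO character `μ`) is unramified and defines `η̂₁ : ℋ(G̃, ω̃) → ℋ(H, ω)` (p. 57); Prop. 4.10.1 (b):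
`Δ̃(δ) Φ^κ_ε(δ, φ) = Φ^{st}(γ, η̂₁ φ)` for `φ ∈ ℋ̃` (the twisted-endoscopic FUNDAMENTAL LEMMA, [BR₁]); Prop. 4.10.2 p. 58: for every unramified character `χ` of
the diagonal torus `M = {d(a, b, ā⁻¹)}` and `π̃ = i_{G̃}(χ ∘ N)`, `Tr(π̃(φ) π̃(ε)) = Tr(i_H(χ)(η̂₁ φ))` — with the SAME `χ` on both sides (`π̃(ε)` fixes the spherical
line, so the twisted trace of `φ ∈ ℋ̃` is its Hecke eigenvalue).  In torus-parameter letters (`χ = χ_z`, `z = χ(d(ϖ, 1, ϖ⁻¹))`): `χ_z ∘ N` has `GL₃`-parameter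
`(z, 1, z⁻¹)` (p. 58: `N(d(x, y, z′)) = d(x∕z̄′, y∕ȳ, z′∕x̄)`), and `i_H(χ_z) = i_{U(Φ₂)}(χ_z) ⊗ 𝟙_{U(1)}` has `U(J₀,2)`-parameter `(z, 1)` (the `U(1)`-factor is
compact, `ℋ(U(1)_v, U(1)_v) = ℂ`, dropped as in FILE D's `SatakeGraph`).  HENCE THE GRAPH OF `η̂₁` IS UNSIGNED:
`GraphBCEta₁ φ fH :⟺ ∀ z ∈ ℂˣ, λ^{GL₃}_{(z,1,z⁻¹)}(φ) = λ^{U(J₀,2)}_{(z,1)}(fH)` — contrast FILE D's `SatakeGraph` for `ξ̂_H` (`(φ^H)^∧(z) = φ^∧(−z)`: there `μ = χ_{−1}`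
enters through `ξ_H|_{W_E}`), so `η̂₁ ≠ ξ̂_H ∘ ψ̂_G` on spherical algebras — they differ by the involution `z ↦ −z` of `ℋ(U(J₀,2)) = ℂ[T₁]`.
CURRENCY = ★ p09's: `GL₃` side `(isIwasawaExponent_gl (n := 3) hϖ).heckeEigencharacter wt (laurentMonomialHom ![z, 1, z⁻¹]) φ` over ANY discretely valued `K`
(= FILE D's `glHeckeEigencharUnit L v w (rogawskiParamBC z) φ` by `rfl` at `K = L_w`, junction probe in ★ W7-b (i)); `U(J₀,2)` side ★
`unitaryHeckeEigencharacterAdic c hc1 v w hw hv ![z, 1] fH` (= FILE D's `rogawskiParamH z` by `rfl`).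

* `etaOneGraph_partner_exists` ∕ `etaOneGraph_partner_unique` ∕ `etaOneGraph_partner_existsUnique` — **∀ φ ∃! fH, GraphBCEta₁ φ fH** (existence:
  `λ^{GL₃}_{(z,1,z⁻¹)}(φ) = Q_φ(z + z⁻¹)` by ★ `glHeckeEigenpoly_bcLine_even`, and `Q_φ(z + z⁻¹)` is a `U(J₀,2)` eigen-polynomial by ★ `exists_hecke_eigenpoly_two`;
  uniqueness: ★ `satakeGraph_partner_unique`);
* `eigencharacter_two_eq_gl_neg_of_graphBC_of_satakeGraph` — (E.6): `GraphBC₃ φ f ∧ SatakeGraph f φH′ ⇒ λ^{U(2)}_{(z,1)}(φH′) = λ^{GL₃}_{(−z,1,(−z)⁻¹)}(φ)`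
  (the composite `ξ̂_H ∘ ψ̂_G` has the SIGNED graph; `η̂₁` and `ξ̂_H ∘ ψ̂_G` differ by `z ↦ −z`).
(The partner `etaOneGraphPartner` ∕ `etaOneGraphPartnerAlgHom` and their laws: sequel `Theorems/R90S6EtaOneGraphPartner.lean`.)
The pins at `K = L_𝔴` (`hϖ`, `hu`, the DVR ∕ finite-residue-field ∕ Hecke-pair instances) are ★ p09's §4 [Theorems/R90S6BCGraphPartner.lean :257–:292] — not restated.

HONEST LABEL: local spherical Hecke-algebra bookkeeping; proves no printed global statement and NOT the fundamental lemma Prop. 4.10.1 (b) itself (that is the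
E1.4.4.5b socket, deferred); count-neutral until E1.4.4.3.x ∕ E1.4.4.5b consume `GraphBCEta₁`.  HC_CM is proved only modulo the 7 printed citations (2 remaining
named inputs: hLiu418 = stmt-HodgeConjecture-24832, h413 = stmt-HodgeConjecture-24833) until rung 0 closes; REL ≠ ★ ≠ BUILT.

## References
* [Rogawski1990] J. D. Rogawski, *Automorphic Representations of Unitary Groups in Three Variables*, Ann. of Math. Stud. 123 (1990), §4.7 p. 48 (`η₁`, `η₂`),
  §4.10 pp. 56–58 (Prop. 4.10.1 (b), Prop. 4.10.2), §4.9 p. 55.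
* [CartierCorvallis1979] P. Cartier, *Representations of 𝔭-adic groups: a survey*, PSPM 33.1 (1979), §IV (4.2)–(4.4), Thm. 4.1, Cor. 4.2.
-/

set_option autoImplicit false
-- the mandated namespace repeats the single-problem summit's segment (`HodgeConjecture.HodgeConjecture`)
set_option linter.dupNamespace false

noncomputable section

open NumberField IsDedekindDomain
open Literature.NumberTheory.Automorphic Literature.NumberTheory.Automorphic.HermitianLattice Literature.NumberTheory.Automorphic.UnitaryGroup
open scoped MatrixGroups
open ValuativeRel

namespace Summit.HodgeConjecture.HodgeConjecture.R90.S6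

universe u

section Partner

variable {F E : Type} [Field F] [NumberField F] [Field E] [NumberField E] [Algebra F E] [Algebra.IsQuadraticExtension F E]
  (c : E ≃ₐ[F] E) (hc1 : c ≠ 1) (v : HeightOneSpectrum (𝓞 F)) (w : PlacesOver E v) (hw : c • w.1 = w.1)
  (hv : Algebra.IsUnramifiedIn (𝓞 E) v.asIdeal)
  {K : Type u} [Field K] [ValuativeRel K] [IsDiscreteValuationRing 𝒪[K]] [Finite 𝓀[K]] {ϖ : K}
  [IsHeckeTriple (⊤ : Submonoid (GL (Fin 3) K)) (glInt 3 K) (glInt 3 K)]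
  (hϖ : IsUniformizingElement ϖ) {u : ℂˣ} (hu : (u : ℂ) ^ 2 = ((Nat.card 𝓀[K] : ℕ) : ℂ))
  {wt : Multiplicative (Fin 3 → ℤ) →* ℂ}
  (hwt : ∀ e : Fin 3 → ℤ, wt (Multiplicative.ofAdd e) = ((u ^ ((((3 : ℕ) : ℤ) - 1) * (∑ i, e i) - 2 * satakeTwistExp e) : ℂˣ) : ℂ))

/-! ## §1 `∀ φ ∃! f, GraphBCEta₁ φ f` -/

section Exists

include hu hwt

/-- **Existence of the η̂₁-graph partner** [Rogawski1990, §4.10 Prop. 4.10.1 (b), Prop. 4.10.2 pp. 57–58]: for every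
`φ ∈ ℋ(GL₃(K), GL₃(𝒪))` there is `f ∈ ℋ(U(J₀,2)(E_w), K₀)` with `λ^{GL₃}_{(z,1,z⁻¹)}(φ) = λ^{U(J₀,2)}_{(z,1)}(f)` for ALL `z ∈ ℂˣ`
(`λ^{GL₃}_{(z,1,z⁻¹)}(φ) = Q_φ(z + z⁻¹)` by ★ `glHeckeEigenpoly_bcLine_even`, and `Q_φ(z + z⁻¹)` is a `U(2)` eigen-polynomial by
★ `exists_hecke_eigenpoly_two`). [cite: Rogawski1990, §4.10 Prop. 4.10.1 (b) pp. 57–58] [cite: CartierCorvallis1979, §IV Thm. 4.1] -/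
theorem etaOneGraph_partner_exists (φ : heckeAlgebra ℂ (GL (Fin 3) K) (glInt 3 K)) :
    ∃ f : heckeAlgebra ℂ ↥(unitaryGroupOfForm (galAdicCompletionMap (L := E) c hw) ((StdForm.antidiagonal 2).over (w.1.adicCompletion E)))
        (unitaryInt (galAdicCompletionMap (L := E) c hw) ((StdForm.antidiagonal 2).over (w.1.adicCompletion E))),
      ∀ z : ℂˣ, (isIwasawaExponent_gl (n := 3) hϖ).heckeEigencharacter wt (laurentMonomialHom ![z, 1, z⁻¹]) φ =
        unitaryHeckeEigencharacterAdic c hc1 v w hw hv ![z, 1] f := by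
  obtain ⟨Q, hQ⟩ := glHeckeEigenpoly_bcLine_even hϖ hu hwt φ
  obtain ⟨f, hf⟩ := exists_hecke_eigenpoly_two c hc1 v w hw hv Q
  exact ⟨f, fun z => (hQ z).trans (hf z).symm⟩

end Exists

omit [Finite 𝓀[K]] [IsHeckeTriple (⊤ : Submonoid (GL (Fin 3) K)) (glInt 3 K) (glInt 3 K)] in
/-- **Uniqueness of the η̂₁-graph partner**: two `f, f′ ∈ ℋ(U(J₀,2)(E_w), K₀)` in graph position with the same `φ` are equal
(★ `satakeGraph_partner_unique`: the `λ_{(z,1)}` separate `ℋ(U(J₀,2)(E_w), K₀)`). [cite: Rogawski1990, §4.10 p. 57]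
[cite: CartierCorvallis1979, §IV Cor. 4.2] -/
theorem etaOneGraph_partner_unique (φ : heckeAlgebra ℂ (GL (Fin 3) K) (glInt 3 K))
    (f f' : heckeAlgebra ℂ ↥(unitaryGroupOfForm (galAdicCompletionMap (L := E) c hw) ((StdForm.antidiagonal 2).over (w.1.adicCompletion E)))
      (unitaryInt (galAdicCompletionMap (L := E) c hw) ((StdForm.antidiagonal 2).over (w.1.adicCompletion E))))
    (hf : ∀ z : ℂˣ, (isIwasawaExponent_gl (n := 3) hϖ).heckeEigencharacter wt (laurentMonomialHom ![z, 1, z⁻¹]) φ =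
      unitaryHeckeEigencharacterAdic c hc1 v w hw hv ![z, 1] f)
    (hf' : ∀ z : ℂˣ, (isIwasawaExponent_gl (n := 3) hϖ).heckeEigencharacter wt (laurentMonomialHom ![z, 1, z⁻¹]) φ =
      unitaryHeckeEigencharacterAdic c hc1 v w hw hv ![z, 1] f') :
    f = f' :=
  satakeGraph_partner_unique c hc1 v w hw hv f f' fun z => (hf z).symm.trans (hf' z)

include hu hwt

/-- **W10-a `∀ φ ∃! f, GraphBCEta₁ φ f`** — print's `η̂₁ : ℋ(G̃, ω̃) → ℋ(H, ω)` is well defined by its Satake graph.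
[cite: Rogawski1990, §4.10 Prop. 4.10.1 (b) pp. 57–58] [cite: CartierCorvallis1979, §IV Thm. 4.1, Cor. 4.2] -/
theorem etaOneGraph_partner_existsUnique (φ : heckeAlgebra ℂ (GL (Fin 3) K) (glInt 3 K)) :
    ∃! f : heckeAlgebra ℂ ↥(unitaryGroupOfForm (galAdicCompletionMap (L := E) c hw) ((StdForm.antidiagonal 2).over (w.1.adicCompletion E)))
        (unitaryInt (galAdicCompletionMap (L := E) c hw) ((StdForm.antidiagonal 2).over (w.1.adicCompletion E))),
      ∀ z : ℂˣ, (isIwasawaExponent_gl (n := 3) hϖ).heckeEigencharacter wt (laurentMonomialHom ![z, 1, z⁻¹]) φ =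
        unitaryHeckeEigencharacterAdic c hc1 v w hw hv ![z, 1] f := by
  obtain ⟨f, hf⟩ := etaOneGraph_partner_exists c hc1 v w hw hv hϖ hu hwt φ
  exact ⟨f, hf, fun f' hf' => etaOneGraph_partner_unique c hc1 v w hw hv hϖ φ f' f hf' hf⟩

/-! ## §1′ (E.6) The sign, documented once: the composite of the two ★ partners `ξ̂_H ∘ ψ̂_G` has the SIGNED graph -/

omit hu hwt [Finite 𝓀[K]] [IsHeckeTriple (⊤ : Submonoid (GL (Fin 3) K)) (glInt 3 K) (glInt 3 K)] in
/-- **(E.6) `η̂₁ ≠ ξ̂_H ∘ ψ̂_G` on spherical algebras — the sign, documented once.**  If `f ∈ ℋ(U(J₀,3)(E_w), K₀)` is in base-change graph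
position with `φ` (FILE D's `GraphBC₃ φ f`: `λ^{GL₃}_{(z,1,z⁻¹)}(φ) = λ^{U(3)}_{(z,1,1)}(f)`, ★ `bcGraphPartnerAlgHom`) and `φH′ ∈ ℋ(U(J₀,2)(E_w), K₀)` is in
Satake-graph position with `f` (FILE D's `SatakeGraph f φH′`: `λ^{U(2)}_{(z,1)}(φH′) = λ^{U(3)}_{(−z,1,1)}(f)`, ★ `satakeGraphPartnerAlgHom`; the sign is `μ_w = χ_{−1}`
in `ξ_H|_{W_E}`, [Rogawski1990, L. 4.9.2]), then `λ^{U(2)}_{(z,1)}(φH′) = λ^{GL₃}_{(−z,1,(−z)⁻¹)}(φ)` for all `z` — the graph of print's NON-endoscopic composite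
`ψ_G ∘ ξ_H` (§4.8 p. 54: «transfer via `ψ_G ∘ ξ_H` is `i_P(ψ′_H(ρ))`»), i.e. `ξ̂_H(ψ̂_G φ)` and `η̂₁(φ)` differ by the involution `z ↦ −z` of `ℋ(U(J₀,2)) = ℂ[T₁]`.
[cite: Rogawski1990, §4.7 p. 48; §4.8 p. 54; §4.10 Prop. 4.10.2 p. 58] -/
theorem eigencharacter_two_eq_gl_neg_of_graphBC_of_satakeGraph (φ : heckeAlgebra ℂ (GL (Fin 3) K) (glInt 3 K))
    (f : heckeAlgebra ℂ ↥(unitaryGroupOfForm (galAdicCompletionMap (L := E) c hw) ((StdForm.antidiagonal 3).over (w.1.adicCompletion E)))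
      (unitaryInt (galAdicCompletionMap (L := E) c hw) ((StdForm.antidiagonal 3).over (w.1.adicCompletion E))))
    (φH' : heckeAlgebra ℂ ↥(unitaryGroupOfForm (galAdicCompletionMap (L := E) c hw) ((StdForm.antidiagonal 2).over (w.1.adicCompletion E)))
      (unitaryInt (galAdicCompletionMap (L := E) c hw) ((StdForm.antidiagonal 2).over (w.1.adicCompletion E))))
    (hbc : ∀ z : ℂˣ, (isIwasawaExponent_gl (n := 3) hϖ).heckeEigencharacter wt (laurentMonomialHom ![z, 1, z⁻¹]) φ =
      unitaryHeckeEigencharacterAdic c hc1 v w hw hv ![z, 1, 1] f)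
    (hsat : ∀ z : ℂˣ, unitaryHeckeEigencharacterAdic c hc1 v w hw hv ![z, 1] φH' =
      unitaryHeckeEigencharacterAdic c hc1 v w hw hv ![-z, 1, 1] f) (z : ℂˣ) :
    unitaryHeckeEigencharacterAdic c hc1 v w hw hv ![z, 1] φH' =
      (isIwasawaExponent_gl (n := 3) hϖ).heckeEigencharacter wt (laurentMonomialHom ![-z, 1, (-z)⁻¹]) φ :=
  (hsat z).trans (hbc (-z)).symm

end Partner

end Summit.HodgeConjecture.HodgeConjecture.R90.S6

end
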